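import Summits.ResolutionOfSingularities.ResolutionOfSingularities.Theorems.FrobeniusLadderFInjectiveMacaulayficationCoactionRees
import HarnessLib

/-!
# Veronese subalgebras of a ring with a Laurent coaction (crux `FInjectiveMacaulayfication`, §17 G4♮, pieces (F1)/(F3))

Support file for crux stmt-ResolutionOfSingularities-15315 (`FrobeniusLadder.FInjectiveMacaulayfication`,
line `graded-engine` / filtered engine §17, CRUX-PLAN w45a v5 §1.3 pieces (F1) and (F3), owner stub-4). [OURS · L1 W4.5a]

RING-LEVEL twin of `…CoactionRees`: there the graded ring was `L[X]` with the coaction living on `L` and `deg X = -1`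
(the extended Rees algebra of the GRADED engine G4); the FILTERED engine G4♮ works on `T′♮ = (k[X,s]/(f^h))[1/X_v]`,
which is not a polynomial ring over a graded ring, so here the coaction `γ : B →+* B[T;T⁻¹]` lives on the ring `B`
itself (`γ` = the `(w,-1)`-grading: `Xⱼ ↦ Xⱼ T^{wⱼ}`, `s ↦ s T⁻¹`). Everything is carrier-independent: the (F0)
carrier only has to supply `γ` with counit/coassociativity, the homogeneous generators, the degree-`-1` element `s`
and the degree-`N` unit `X_v^c`.

* `exists_degSubalgebra` — for a coaction `γ : B →+* B[M]` sending `k` to degree `0`, the `k`-subalgebra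
  `{b | γ b = single 0 b}` of degree-`0` elements; instances: `T₀` (`γ = β`, `M = ℤ`) and the `N`-VERONESE subalgebra
  `A′` (`γ = β̄ := mapDomain (ℤ → ℤ/N) ∘ β`);
* `exists_retraction_ring` — `b ↦ (γ b)₀` is an `A`-linear retraction `B → A` onto that subalgebra when components are
  homogeneous;
* `mem_veronese_of_hom` (`β b = single d b`, `N ∣ d` ⇒ `b ∈ A′`), `pow_mem_veronese` (`b` homogeneous ⇒ `b^N ∈ A′`),
  `isIntegral_veronese_ring` (`B` integral over `A′` when generated by homogeneous
  elements, `SubalgebraIntegralOfPow` #12).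

Folklore (Veronese subrings `R^{(N)}`, e.g. Goto–Watanabe 1978 Ch. 3); no definitions, no named facts.
-/

-- single-problem summit: the doubled namespace component is forced
set_option linter.dupNamespace false

noncomputable section

open scoped LaurentPolynomial
open AddMonoidAlgebra LaurentPolynomial
open Summit.ResolutionOfSingularities.ResolutionOfSingularities.Theorems.FInjectiveMacaulayfication
open Summit.ResolutionOfSingularities.ResolutionOfSingularities.Theorems.FInjectiveMacaulayfication.LaurentCoaction
open Summit.ResolutionOfSingularities.ResolutionOfSingularities.Theorems.FInjectiveMacaulayfication.CoactionRees

namespace Summit.ResolutionOfSingularities.ResolutionOfSingularities.Theorems.FInjectiveMacaulayfication.RingVeronese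

variable {k B : Type} [Field k] [CommRing B] [Algebra k B]

/-! ## The degree-zero subalgebra of a coaction and its retraction -/

/-- **The degree-`0` subalgebra of a coaction** `γ : B →+* B[M]` sending `k` to degree `0`: the elements with
`γ b = single 0 b` form a `k`-subalgebra. [folklore] -/
theorem exists_degSubalgebra {M : Type} [AddCommMonoid M] (γ : B →+* AddMonoidAlgebra B M)
    (hγk : ∀ c : k, γ (algebraMap k B c) = single 0 (algebraMap k B c)) :
    ∃ A : Subalgebra k B, ∀ b : B, b ∈ A ↔ γ b = single 0 b := by
  refine ⟨{ carrier := {b | γ b = single 0 b}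
            mul_mem' := fun {a b} ha hb => ?_, one_mem' := ghom_one γ, add_mem' := fun {a b} ha hb => ghom_add ha hb,
            zero_mem' := ghom_zero γ 0, algebraMap_mem' := hγk }, fun b => Iff.rfl⟩
  have h := ghom_mul ha hb
  rwa [add_zero] at h

/-- **The retraction onto the degree-`0` subalgebra**: if components are homogeneous, `b ↦ (γ b)₀` is an `A`-linear
retraction `B → A`. [folklore] -/
theorem exists_retraction_ring {M : Type} [AddCommGroup M] (γ : B →+* AddMonoidAlgebra B M)
    (hΔ : ∀ (b : B) (x : M), γ ((γ b).coeff x) = single x ((γ b).coeff x))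
    (A : Subalgebra k B) (hA : ∀ b : B, b ∈ A ↔ γ b = single 0 b) :
    ∃ ρ : B →ₗ[A] A, ∀ a : A, ρ a = a := by
  classical
  have hmem : ∀ b : B, (γ b).coeff 0 ∈ A := fun b => (hA _).mpr (hΔ b 0)
  have hsmul : ∀ (a : A) (b : B), (γ ((a : B) * b)).coeff 0 = (a : B) * (γ b).coeff 0 := fun a b => by
    rw [map_mul, (hA _).mp a.2]
    have h := coeff_single_mul_add (γ b) (a : B) (0 : M) 0
    rwa [add_zero] at h
  have hid : ∀ a : A, (γ (a : B)).coeff 0 = a := fun a => by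
    rw [(hA _).mp a.2, coeff_single, Finsupp.single_eq_same]
  refine ⟨{ toFun := fun b => ⟨(γ b).coeff 0, hmem b⟩
            map_add' := fun a b => Subtype.ext (by
              simp only [map_add, coeff_add, Finsupp.add_apply, Subalgebra.coe_add])
            map_smul' := fun a b => Subtype.ext ?_ }, fun a => Subtype.ext (hid a)⟩
  show (γ (a • b)).coeff 0 = (((RingHom.id A) a • (⟨(γ b).coeff 0, hmem b⟩ : A) : A) : B)
  rw [RingHom.id_apply, Subalgebra.smul_def, smul_eq_mul, smul_eq_mul, Subalgebra.coe_mul]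
  exact hsmul a b

/-! ## The Veronese subalgebra of a Laurent coaction -/

section Veronese

variable (β : B →+* B[T;T⁻¹]) (N : ℕ) (A' : Subalgebra k B)
  (hA' : ∀ b : B, b ∈ A' ↔ (mapDomainRingHom B (Int.castAddHom (ZMod N))).comp β b = single 0 b)

include hA' in
/-- A homogeneous element of degree divisible by `N` lies in the Veronese subalgebra. [folklore] -/
theorem mem_veronese_of_hom {b : B} {d : ℤ} (hb : β b = single d b) (hd : (N : ℤ) ∣ d) : b ∈ A' := by
  refine (hA' b).mpr ?_
  rw [hom_zmod β N hb, (ZMod.intCast_zmod_eq_zero_iff_dvd d N).mpr hd]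

include hA' in
/-- The `N`-th power of a homogeneous element lies in the Veronese subalgebra. [folklore] -/
theorem pow_mem_veronese {b : B} {d : ℤ} (hb : β b = single d b) : b ^ N ∈ A' :=
  mem_veronese_of_hom β N A' hA' (hom_pow hb N) (Dvd.intro d rfl)

include hA' in
/-- **`B` is integral over the Veronese subalgebra** when `B` is generated over `k` by homogeneous elements (each
generator has its `N`-th power in `A′`). [folklore] -/
theorem isIntegral_veronese_ring (hN : 0 < N) (G : Set B) (hG : ∀ g ∈ G, ∃ d : ℤ, β g = single d g)
    (hgen : Algebra.adjoin k G = ⊤) : Algebra.IsIntegral A' B := by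
  refine SubalgebraIntegralOfPow.stub_subalgebraIntegralOfPow k B A' G hgen fun g hg => ?_
  obtain ⟨d, hd⟩ := hG g hg
  exact ⟨N, hN, pow_mem_veronese β N A' hA' hd⟩

end Veronese

end Summit.ResolutionOfSingularities.ResolutionOfSingularities.Theorems.FInjectiveMacaulayfication.RingVeronese

end
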